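import Literature.AlgebraicGeometry.Morphisms.SectionConormalChart
import Literature.RingTheory.Smooth.AugmentationIdealCotangentLocalizedBase
import Mathlib.AlgebraicGeometry.Morphisms.FinitePresentation
import HarnessLib

/-!
# Finiteness of the chart ring of an affine open and of the conormal module of a section

Topic `Literature/AlgebraicGeometry/Morphisms`, namespace `Literature.AlgebraicGeometry.Morphisms`.  THEOREMS ONLY
(no definition, no named fact, no `instance`; net debt 0).  Sequel of `Morphisms/SectionConormalChart` (the chart ring
`ChartRing f W = Γ(X, W)` of an `R`-scheme `f : X → Spec R` as an `R`-algebra, the augmentation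
`sectionAug f e he heW : ChartRing f W →ₐ[R] R` of a section `e`) and of
`RingTheory/Smooth/AugmentationIdealCotangentLocalizedBase` (§2 there: `I/I²` of an augmentation ideal is finite over the
base as soon as it is finite over `S`; §4: generic freeness of `I/I²` over a noetherian domain, under
`[Module.Finite S (augIdeal ε).Cotangent]`).  Cell `hodgecm-mathlib`, row II-2β, brick «J1-alg» (A-p14 05:02:56Z):
the finiteness inputs of the conormal module of the unit section of an abelian scheme on its affine chart.

THE PRINT.  For `f : X → Spec R` locally of finite type and `W ⊆ X` an affine open, `Γ(X, W)` is an `R`-algebra of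
finite type ([StacksProject, Tag 01T2]); over a noetherian `R` it is therefore a noetherian ring (Hilbert's basis
theorem, [StacksProject, Tag 00FN]), so every ideal `I ⊆ Γ(X, W)` — in particular the ideal `I = ker e^♯` of a section —
is finitely generated and its conormal module `I/I²` ([GortzWedhorn2023, (17.3)]) is a finite `Γ(X, W)`-module, hence a
finite `R`-module (`Γ(X, W)` acts on `I/I²` through `e^♯`).  Without a noetherian hypothesis: for `f` locally of FINITE
PRESENTATION (e.g. smooth), `Γ(X, W)` is a finitely presented `R`-algebra ([StacksProject, Tag 01TQ]) and the kernel of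
the surjection `e^♯ : Γ(X, W) → R` onto the finitely presented `R`-algebra `R` is finitely generated
([StacksProject, Tag 00R2]), with the same conclusion.

WHAT IS HERE (`f : X ⟶ Spec R`, `W` an affine open, `e` a section with `e⁻¹ W = ⊤`):
* §1 `finiteType_chartRing` (`[LocallyOfFiniteType f]`), `finitePresentation_chartRing`
  (`[LocallyOfFinitePresentation f]`), `isNoetherianRing_chartRing` (`[IsNoetherianRing R] [LocallyOfFiniteType f]`) —
  Mathlib's `HasRingHomProperty.appLE` for `Γ(Spec R, ⊤) → Γ(X, W)` composed with `R ≅ Γ(Spec R, ⊤)`.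
* §2 the conormal module of a section on the chart: `fg_augIdeal_sectionAug` (the ideal of the section is finitely
  generated, `[LocallyOfFinitePresentation f]`), **`finite_cotangent_sectionAug_chartRing`** /
  **`finite_cotangent_sectionAug`** (`I/I²` finite over `Γ(X, W)` / over `R`, `[LocallyOfFinitePresentation f]`, ANY `R`),
  and the noetherian editions `finite_cotangent_sectionAug_chartRing_of_isNoetherianRing` /
  `finite_cotangent_sectionAug_of_isNoetherianRing` (`[IsNoetherianRing R] [LocallyOfFiniteType f]`).
* §3 the package for row II-2β: over a noetherian domain `R`, some `r ≠ 0` makes the base-changed conormal module free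
  and finite over `R[1/r]` (`exists_ne_zero_free_cotangent_sectionAug_baseChange`, = §4 of
  `AugmentationIdealCotangentLocalizedBase` at `S := Γ(X, W)`).
For an abelian scheme `𝒜 → Spec R` (structure map proper and smooth, tree `AbelianSchemes.AbelianScheme`) both
`LocallyOfFiniteType` (from `IsProper`) and `LocallyOfFinitePresentation` (from `Smooth`) hold for the structure map and
for all its base changes, so every statement here applies to the unit-section chart of
`AbelianSchemes/AbelianSchemeUnitSectionChart` (`exists_unitSection_chart`) with `haveI := (𝒜.baseChange φ).isProper` /
`(𝒜.baseChange φ).isSmooth`.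
NOT HERE: anything specific to abelian schemes (kept CM-free and group-free; the instantiation is a `haveI`), the
identification of the conormal module of a base-changed chart with the base change of the conormal module (A-p03's G3b).

## References
* [StacksProject] The Stacks Project, Tags 01T2 (finite type on affine opens), 01TQ (finite presentation on affine opens),
  00FN (Hilbert basis), 00R2 (kernel of a surjection onto a finitely presented algebra), 00RU (conormal module).
* [GortzWedhorn2023] U. Görtz, T. Wedhorn, *Algebraic Geometry II* (2023), (17.3) (17.3.1) (conormal module of an immersion).
* [EGAIV3] A. Grothendieck, *Éléments de géométrie algébrique* IV₃ (1966), (8.9.4) (generic freeness).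
-/

noncomputable section

-- `TopCat.Presheaf` is not reducible (as in `Morphisms/SectionConormalChart`).
set_option backward.isDefEq.respectTransparency false

open CategoryTheory AlgebraicGeometry TopologicalSpace Opposite
open Literature.RingTheory.Smooth

universe u

namespace Literature.AlgebraicGeometry.Morphisms

open ChartRing

variable {R : Type u} [CommRing R] {X : Scheme.{u}} (f : X ⟶ Spec (.of R)) {W : X.Opens}

/-! ## §1 The chart ring of an affine open is of finite type / finitely presented / noetherian -/

/-- The comparison `R → Γ(Spec R, ⊤)` (inverse of Mathlib's `ΓSpecIso`) is bijective. [folklore] -/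
private theorem ΓSpecIso_inv_bijective :
    Function.Bijective ((Scheme.ΓSpecIso (.of R)).inv.hom : R → Γ(Spec (.of R), ⊤)) :=
  (Scheme.ΓSpecIso (.of R)).commRingCatIsoToRingEquiv.symm.bijective

/-- The identity cast `mk : Γ(X, W) → ChartRing f W` is surjective. [folklore] -/
private theorem mk_surjective (W : X.Opens) : Function.Surjective (mk f W) := fun s => ⟨val s, mk_val f W s⟩

/-- **`Γ(X, W)` is an `R`-algebra of finite type** for `f : X → Spec R` locally of finite type and `W ⊆ X` an affine
open. [cite: StacksProject, Tag 01T2] -/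
theorem finiteType_chartRing [LocallyOfFiniteType f] (hW : IsAffineOpen W) : Algebra.FiniteType R (ChartRing f W) := by
  have h1 : (f.appLE ⊤ W le_top).hom.FiniteType :=
    HasRingHomProperty.appLE @LocallyOfFiniteType f inferInstance ⟨⊤, isAffineOpen_top _⟩ ⟨W, hW⟩ le_top
  have h2 : ((Scheme.ΓSpecIso (.of R)).inv ≫ f.appLE ⊤ W le_top).hom.FiniteType := by
    rw [CommRingCat.hom_comp]
    exact h1.comp (RingHom.FiniteType.of_surjective _ (ΓSpecIso_inv_bijective).2)
  exact (RingHom.FiniteType.of_surjective _ (mk_surjective f W)).comp h2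

/-- **`Γ(X, W)` is a finitely presented `R`-algebra** for `f : X → Spec R` locally of finite presentation (e.g. smooth)
and `W ⊆ X` an affine open. [cite: StacksProject, Tag 01TQ] -/
theorem finitePresentation_chartRing [LocallyOfFinitePresentation f] (hW : IsAffineOpen W) :
    Algebra.FinitePresentation R (ChartRing f W) := by
  have h1 : (f.appLE ⊤ W le_top).hom.FinitePresentation :=
    HasRingHomProperty.appLE @LocallyOfFinitePresentation f inferInstance ⟨⊤, isAffineOpen_top _⟩ ⟨W, hW⟩ le_top
  have h0 : ((Scheme.ΓSpecIso (.of R)).inv.hom : R →+* Γ(Spec (.of R), ⊤)).FinitePresentation :=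
    RingHom.FinitePresentation.of_surjective _ (ΓSpecIso_inv_bijective).2 (by
      rw [(RingHom.injective_iff_ker_eq_bot _).1 (ΓSpecIso_inv_bijective).1]
      exact Submodule.fg_bot)
  have h2 : ((Scheme.ΓSpecIso (.of R)).inv ≫ f.appLE ⊤ W le_top).hom.FinitePresentation := by
    rw [CommRingCat.hom_comp]
    exact h1.comp h0
  have h3 : (mk f W).FinitePresentation :=
    RingHom.FinitePresentation.of_surjective _ (mk_surjective f W) (by
      rw [(RingHom.injective_iff_ker_eq_bot _).1 (fun _ _ h => h)]
      exact Submodule.fg_bot)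
  exact h3.comp h2

/-- **`Γ(X, W)` is a noetherian ring** for `f : X → Spec R` locally of finite type over a NOETHERIAN `R` and `W ⊆ X` an
affine open (Hilbert's basis theorem). [cite: StacksProject, Tag 00FN] -/
theorem isNoetherianRing_chartRing [IsNoetherianRing R] [LocallyOfFiniteType f] (hW : IsAffineOpen W) :
    IsNoetherianRing (ChartRing f W) :=
  haveI := finiteType_chartRing f hW
  Algebra.FiniteType.isNoetherianRing R (ChartRing f W)

/-! ## §2 The conormal module of a section on an affine chart is finite -/

section Section

variable (e : Spec (.of R) ⟶ X) (he : e ≫ f = 𝟙 _) (heW : e ⁻¹ᵁ W = ⊤)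

/-- The augmentation `e^♯ : Γ(X, W) → R` of a section is surjective (it is a retraction of the structure map).
[cite: GortzWedhorn2023, (17.3)] -/
theorem sectionAug_surjective : Function.Surjective (sectionAug f e he heW) := fun r =>
  ⟨algebraMap R (ChartRing f W) r, (sectionAug f e he heW).commutes r⟩

/-- **The ideal `I = ker e^♯` of a section is finitely generated** on an affine chart `W` of an `R`-scheme locally of
finite presentation (kernel of a surjection of the finitely presented `R`-algebra `Γ(X, W)` onto `R`).
[cite: StacksProject, Tag 00R2] -/
theorem fg_augIdeal_sectionAug [LocallyOfFinitePresentation f] (hW : IsAffineOpen W) :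
    (augIdeal (sectionAug f e he heW)).FG := by
  haveI := finitePresentation_chartRing f hW
  exact Algebra.FinitePresentation.ker_fG_of_surjective (sectionAug f e he heW) (sectionAug_surjective f e he heW)

/-- **The conormal module `I/I²` of a section is a finite `Γ(X, W)`-module** on an affine chart `W` of an `R`-scheme
locally of finite presentation over ANY `R` (a quotient of the finitely generated ideal `I`).
[cite: GortzWedhorn2023, (17.3) (17.3.1)] [cite: StacksProject, Tag 00RU] -/
theorem finite_cotangent_sectionAug_chartRing [LocallyOfFinitePresentation f] (hW : IsAffineOpen W) :
    Module.Finite (ChartRing f W) (augIdeal (sectionAug f e he heW)).Cotangent := by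
  haveI : Module.Finite (ChartRing f W) (augIdeal (sectionAug f e he heW)) :=
    Module.Finite.iff_fg.mpr (fg_augIdeal_sectionAug f e he heW hW)
  exact Module.Finite.of_surjective _ (augIdeal (sectionAug f e he heW)).toCotangent_surjective

/-- **The conormal module `I/I²` of a section is a finite `R`-module** on an affine chart `W` of an `R`-scheme locally
of finite presentation over ANY `R` (`Γ(X, W)` acts on `I/I²` through `e^♯`, tree
`finite_cotangent_augIdeal_of_finite`). [cite: GortzWedhorn2023, (17.3) (17.3.1)] [cite: StacksProject, Tag 00RU] -/
theorem finite_cotangent_sectionAug [LocallyOfFinitePresentation f] (hW : IsAffineOpen W) :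
    Module.Finite R (augIdeal (sectionAug f e he heW)).Cotangent :=
  haveI := finite_cotangent_sectionAug_chartRing f e he heW hW
  finite_cotangent_augIdeal_of_finite (sectionAug f e he heW)

/-- Noetherian edition: over a NOETHERIAN `R`, for `f` locally of finite type, the conormal module of a section on an
affine chart is a finite `Γ(X, W)`-module (`Γ(X, W)` is noetherian, so `I` is finitely generated).
[cite: GortzWedhorn2023, (17.3) (17.3.1)] [cite: StacksProject, Tag 00FN] -/
theorem finite_cotangent_sectionAug_chartRing_of_isNoetherianRing [IsNoetherianRing R] [LocallyOfFiniteType f]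
    (hW : IsAffineOpen W) : Module.Finite (ChartRing f W) (augIdeal (sectionAug f e he heW)).Cotangent :=
  haveI := isNoetherianRing_chartRing f hW
  Module.Finite.of_surjective _ (augIdeal (sectionAug f e he heW)).toCotangent_surjective

/-- Noetherian edition: over a NOETHERIAN `R`, for `f` locally of finite type, the conormal module of a section on an
affine chart is a finite `R`-module (tree `finite_cotangent_augIdeal` at the noetherian `S := Γ(X, W)`).
[cite: GortzWedhorn2023, (17.3) (17.3.1)] [cite: StacksProject, Tag 00FN] -/
theorem finite_cotangent_sectionAug_of_isNoetherianRing [IsNoetherianRing R] [LocallyOfFiniteType f]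
    (hW : IsAffineOpen W) : Module.Finite R (augIdeal (sectionAug f e he heW)).Cotangent :=
  haveI := isNoetherianRing_chartRing f hW
  finite_cotangent_augIdeal (sectionAug f e he heW)

/-! ## §3 Generic freeness of the conormal module of a section over a noetherian domain -/

/-- **Generic freeness of the conormal module of a section.**  Over a noetherian DOMAIN `R`, for `f : X → Spec R`
locally of finite presentation, `W` an affine chart of the section `e`: for some `r ≠ 0` the conormal module of the
base-changed augmentation `e^♯_{R[1/r]}` (ideal `augIdealBaseChange`) is FREE and FINITE over `R[1/r]` (tree
`exists_ne_zero_free_cotangent_augIdealBaseChange` at `S := Γ(X, W)`, whose `[Module.Finite S (I/I²)]` is §2).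
[cite: EGAIV3, (8.9.4)] [cite: GortzWedhorn2023, (17.3) (17.3.1)] -/
theorem exists_ne_zero_free_cotangent_sectionAug_baseChange [IsDomain R] [IsNoetherianRing R]
    [LocallyOfFinitePresentation f] (hW : IsAffineOpen W) :
    ∃ r : R, r ≠ 0 ∧
      Module.Free (Localization.Away r) (augIdealBaseChange (sectionAug f e he heW) (Localization.Away r)).Cotangent ∧
      Module.Finite (Localization.Away r) (augIdealBaseChange (sectionAug f e he heW) (Localization.Away r)).Cotangent :=
  haveI := finite_cotangent_sectionAug_chartRing f e he heW hW
  exists_ne_zero_free_cotangent_augIdealBaseChange (sectionAug f e he heW)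

/-- The same with the ideal spelled `augIdeal (baseChangeAugmentation e^♯ R[1/r])` (tree
`exists_ne_zero_free_cotangent_augIdeal_baseChangeAugmentation`). [cite: EGAIV3, (8.9.4)] -/
theorem exists_ne_zero_free_cotangent_sectionAug_baseChangeAugmentation [IsDomain R] [IsNoetherianRing R]
    [LocallyOfFinitePresentation f] (hW : IsAffineOpen W) :
    ∃ r : R, r ≠ 0 ∧
      Module.Free (Localization.Away r)
        (augIdeal (baseChangeAugmentation (sectionAug f e he heW) (Localization.Away r))).Cotangent ∧
      Module.Finite (Localization.Away r)
        (augIdeal (baseChangeAugmentation (sectionAug f e he heW) (Localization.Away r))).Cotangent :=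
  haveI := finite_cotangent_sectionAug_chartRing f e he heW hW
  exists_ne_zero_free_cotangent_augIdeal_baseChangeAugmentation (sectionAug f e he heW)

end Section

end Literature.AlgebraicGeometry.Morphisms

end
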